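import Literature.AlgebraicGeometry.ShimuraVarieties.UnitaryShimuraCurveRecord
import Literature.AlgebraicGeometry.ShimuraVarieties.UnitaryConeDiscontinuity
import HarnessLib

/-!
# The levels of a unitary Shimura-curve record are DISCRETE at the complex place `τ`

Topic `Literature/AlgebraicGeometry/ShimuraVarieties`, namespace
`Literature.AlgebraicGeometry.ShimuraVarieties.UnitaryCanonicalModel`.  Cell `hodgecm-mathlib`, FLOOR 0, crux item
stmt-HodgeConjecture-24832 (hLiu418), E-line socket `stub_SIG` (line L5, organ NOREC-B: the RECORD half of «no record system
uniformises a fake-signature form»).  THEOREMS ONLY (no definition, no named fact, no instance, no `sorry`).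

THE PRINT.  [Deligne1979ShimuraVarieties] 2.1.2: «`_K M_ℂ(G, X)` is a disjoint sum, indexed by `G(ℚ)\G(𝔸^f)/K`, of the quotients
`Γ_g \ X⁺`, `Γ_g = gKg⁻¹ ∩ G(ℚ)`»; [Borel1969] §1 and Prop. 7.13 (an arithmetic subgroup is a discrete subgroup of the real points);
[Milne2005ShimuraVarieties] Prop. 3.2 p. 32 («`Γ` … discrete in `G(ℝ)`»).  In the tree the rank-2 record ★
`UnitaryCanonicalModel.RecordSystemGS` carries the dissection as clause (F2c) `pieces`: at every small level `K` there are
representatives `g_q` of `U(J⋆)(L⁺) \ U(J⋆)(𝔸_f) / K` and ball-uniformisation data `B q` with `(B q).Hℂ = J⋆^τ` and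
`(B q).Γ^{τ₁} = Γ_{J⋆}(g_q K g_q⁻¹)^τ` (★ `arithmeticLevel`), and EVERY ★ `UnitaryBallUniformisationDatum` is DISCRETE at `τ₁`:
★ `UnitaryBallUniformisationDatum.finite_setOf_norm_τ₁_apply_le` (★ `UnitaryConeDiscontinuity` §4: only finitely many `γ ∈ Γ`
have all `τ₁`-entries of norm `≤ R` — the other archimedean places are definite, the group is integral of finite index).

WHAT IS PROVED.  For a record `S : RecordSystemGS L J⋆ τ K₀` and ANY small level `Kc ≤ K₀`:
* `RecordSystemGS.finite_setOf_mem_arithmeticLevel_norm_le` — for every real `R`, only FINITELY MANY `γ ∈ Γ_{J⋆}(Kc) =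
  U(J⋆)(L⁺) ∩ Kc` have all `τ`-entries of norm `≤ R`.  Proof: the double coset of `1·Kc` has the record's representative
  `g_q = γ′ k` (`γ′` rational, `k ∈ Kc`), so `γ ↦ γ′ γ γ′⁻¹` maps `Γ_{J⋆}(Kc)` INJECTIVELY into `Γ_{J⋆}(g_q Kc g_q⁻¹)`, whose
  `τ`-image is the `τ₁`-image of the ball group `(B q).Γ`; the `τ`-entries of `γ′ γ γ′⁻¹` are bounded by `4·C(γ′)·R·C(γ′⁻¹)`,
  so the image lands in the finite set of ★ `finite_setOf_norm_τ₁_apply_le`.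
* `RecordSystemGS.finite_setOf_mem_norm_le_of_le_arithmeticLevel` — the same for every subgroup `Γ ≤ Γ_{J⋆}(Kc)` (e.g. a
  principal congruence subgroup `Γ_{J⋆}(n) ≤ Γ_{J⋆}(Kc)`, ★ `isCongruenceSubgroup_arithmeticLevel_of_isOpen`).
This is the record-side input of the in-house closure of the E-line socket `stub_SIG` (the number-theory side shows that a
`J⋆` indefinite at TWO real places has infinitely many `τ`-bounded elements in every `Γ_{J⋆}(n)`).
HC_CM is proved only modulo the printed citations until rung 0 closes; this file discharges no named fact.
-/

set_option autoImplicit false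

noncomputable section

open Function MulAction NumberField Matrix
open Literature.AlgebraicGeometry.Motives (SchemeOver)
open Literature.NumberTheory.Automorphic Literature.NumberTheory.Automorphic.UnitaryGroup
open Literature.NumberTheory.Automorphic.ShimuraDissection
open Literature.NumberTheory.Automorphic.Liu2021.AppendixC (C5.OpenCompactSubgroup C5.SmallLevel)

namespace Literature.AlgebraicGeometry.ShimuraVarieties

namespace UnitaryCanonicalModel

variable {L : Type} [Field L] [NumberField L] [IsCMField L] {Jstar : Matrix (Fin 2) (Fin 2) L} {τ : L →+* ℂ}
variable {K₀ : C5.OpenCompactSubgroup ↥(finAdelic (↥(maximalRealSubfield L)) L (IsCMField.complexConj L) 2 Jstar)}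

/-- `GL_n` of an injective ring homomorphism is injective (entrywise). [folklore] -/
private theorem glMap_injective' {R S : Type*} [CommRing R] [CommRing S] {m : Type*} [Fintype m] [DecidableEq m]
    {f : R →+* S} (hf : Injective f) : Injective (Matrix.GeneralLinearGroup.map (n := m) f) := fun x y h =>
  Matrix.GeneralLinearGroup.ext fun i j => hf (by
    have := congrArg (fun g : GL m S => (g : Matrix m m S) i j) h
    simpa only [Matrix.GeneralLinearGroup.map_apply] using this)

/-- The matrix of `GL_n(f) g` is `f` applied entrywise to the matrix of `g`. [folklore] -/
private theorem coe_glMap' {R S : Type*} [CommRing R] [CommRing S] {m : Type*} [Fintype m] [DecidableEq m]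
    (f : R →+* S) (g : GL m R) :
    ((Matrix.GeneralLinearGroup.map f g : GL m S) : Matrix m m S) = (g : Matrix m m R).map f := rfl

/-- Entry bound for a product of square complex matrices: `‖(M N)ᵢⱼ‖ ≤ #m · R · S`. [folklore] -/
private theorem norm_mul_apply_le_card'' {m : Type*} [Fintype m] {M N : Matrix m m ℂ} {R S : ℝ} (hM : ∀ i j, ‖M i j‖ ≤ R)
    (hN : ∀ i j, ‖N i j‖ ≤ S) (i j : m) : ‖(M * N) i j‖ ≤ Fintype.card m * (R * S) := by
  rw [Matrix.mul_apply]
  calc ‖∑ k, M i k * N k j‖ ≤ ∑ k, ‖M i k * N k j‖ := norm_sum_le _ _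
    _ ≤ ∑ _k : m, R * S := Finset.sum_le_sum fun k _ ↦ by
        rw [norm_mul]
        exact mul_le_mul (hM i k) (hN k j) (norm_nonneg _) ((norm_nonneg _).trans (hM i k))
    _ = Fintype.card m * (R * S) := by simp

/-- (F2c) UNPACKED AT THE UNIT DOUBLE COSET.  The double coset of `1·Kc` has the record's representative `g_q = γ′ k`
(`γ′` rational, `k ∈ Kc`), so for EVERY `g ∈ U(J⋆)(L⁺)` with `g ∈ Kc` adelically, `γ′ g γ′⁻¹ ∈ Γ_{J⋆}(g_q Kc g_q⁻¹)`, whose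
`τ`-image is the `τ₁`-image of an element `δ` of the ball group `(B q).Γ` of the piece `X q` — with `(B q).Hℂ = J⋆^τ` and ONE
`γ′` serving all `g`. [cite: Deligne1979ShimuraVarieties, 2.1.2] [cite: Milne2005ShimuraVarieties, Lemma 5.13 p. 57] -/
private theorem RecordSystemGS.exists_piece_conj_forall (S : RecordSystemGS L Jstar τ K₀) (Kc : C5.SmallLevel K₀) :
    ∃ (X : SchemeOver ℂ) (D : UnitaryBallUniformisationDatum 1 X)
      (γ' : ↥(rational ↥(maximalRealSubfield L) L (IsCMField.complexConj L) 2 Jstar)),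
      D.Hℂ = Jstar.map τ ∧
        ∀ g : ↥(rational ↥(maximalRealSubfield L) L (IsCMField.complexConj L) 2 Jstar),
          rationalToFinAdelic ↥(maximalRealSubfield L) L (IsCMField.complexConj L) 2 Jstar g ∈ Kc.1.1 →
            ∃ δ : GL (Fin (1 + 1)) ↥D.E, δ ∈ D.Γ ∧
              Matrix.GeneralLinearGroup.map (D.τ₁ : ↥D.E →+* ℂ) δ =
                Matrix.GeneralLinearGroup.map τ
                  ((MulAut.conj γ' g : ↥(rational ↥(maximalRealSubfield L) L (IsCMField.complexConj L) 2 Jstar)) :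
                    GL (Fin 2) L) := by
  letI : Algebra L ℂ := τ.toAlgebra
  have hP := S.pieces Kc
  obtain ⟨gq, hgq, X, ιX, -, B, hB⟩ := hP
  -- the double coset `q` of `1·Kc`, its representative `b := g_q` and its ball datum `D := B q`
  obtain ⟨q, hqa⟩ : ∃ q : orbitRel.Quotient ↥(rational ↥(maximalRealSubfield L) L (IsCMField.complexConj L) 2 Jstar)
      (CosetSpace (rationalToFinAdelic ↥(maximalRealSubfield L) L (IsCMField.complexConj L) 2 Jstar) Kc.1.1),
      q = Quotient.mk'' (CosetSpace.pt (rationalToFinAdelic _ L _ 2 Jstar) Kc.1.1 1) := ⟨_, rfl⟩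
  have hΓ := (hB q).2.1
  have hH := (hB q).1
  have hq := hgq q
  clear hB hgq
  obtain ⟨b, hb⟩ : ∃ b : ↥(finAdelic ↥(maximalRealSubfield L) L (IsCMField.complexConj L) 2 Jstar), gq q = b := ⟨_, rfl⟩
  obtain ⟨D, hD⟩ : ∃ D : UnitaryBallUniformisationDatum 1 (X q), B q = D := ⟨_, rfl⟩
  rw [hb] at hΓ hq
  rw [hD] at hΓ hH
  clear hb hD B gq
  -- `⟦b Kc⟧ = ⟦1 Kc⟧`: `b = γ′ k` with `γ′` rational and `k := (γ′)⁻¹ b ∈ Kc`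
  rw [hqa] at hq
  obtain ⟨γ', hγ'⟩ := mem_orbit_iff.mp (Quotient.eq''.mp hq)
  rw [CosetSpace.smul_pt, CosetSpace.pt_eq_pt_iff, mul_one] at hγ'
  refine ⟨X q, D, γ', hH, fun g hg => ?_⟩
  have hb_eq : b = rationalToFinAdelic _ L _ 2 Jstar γ' * ((rationalToFinAdelic _ L _ 2 Jstar γ')⁻¹ * b) := by
    rw [mul_inv_cancel_left]
  -- `γ′ g γ′⁻¹` is rational with `b⁻¹ (γ′ g γ′⁻¹) b ∈ Kc`
  have hmem : b⁻¹ * rationalToFinAdelic _ L _ 2 Jstar (MulAut.conj γ' g) * b ∈ Kc.1.1 := by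
    have hcalc : b⁻¹ * rationalToFinAdelic _ L _ 2 Jstar (MulAut.conj γ' g) * b =
        ((rationalToFinAdelic _ L _ 2 Jstar γ')⁻¹ * b)⁻¹ * rationalToFinAdelic _ L _ 2 Jstar g *
          ((rationalToFinAdelic _ L _ 2 Jstar γ')⁻¹ * b) := by
      conv_lhs => rw [hb_eq]
      rw [MulAut.conj_apply, map_mul, map_mul, map_inv]
      group
    rw [hcalc]
    exact Kc.1.1.mul_mem (Kc.1.1.mul_mem (Kc.1.1.inv_mem hγ') hg) hγ'
  -- hence `γ′ g γ′⁻¹ ∈ Γ_{J⋆}(b Kc b⁻¹)`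
  have harith : ((MulAut.conj γ' g : ↥(rational ↥(maximalRealSubfield L) L (IsCMField.complexConj L) 2 Jstar)) :
        GL (Fin 2) L) ∈
      arithmeticLevel ↥(maximalRealSubfield L) L (IsCMField.complexConj L) 2 Jstar
        (Kc.1.1.map (MulAut.conj b).toMonoidHom) := by
    refine mem_arithmeticLevel_iff.mpr ⟨(MulAut.conj γ' g).2, ?_⟩
    rw [Subgroup.mem_map_equiv, MulAut.conj_symm_apply]
    exact hmem
  -- read it in `D.Γ` through `τ` and `τ₁`
  have hmapped : Matrix.GeneralLinearGroup.map τ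
      ((MulAut.conj γ' g : ↥(rational ↥(maximalRealSubfield L) L (IsCMField.complexConj L) 2 Jstar)) : GL (Fin 2) L) ∈
      D.Γ.map (Matrix.GeneralLinearGroup.map (D.τ₁ : ↥D.E →+* ℂ)) := by
    rw [hΓ]
    exact Subgroup.mem_map_of_mem _ harith
  obtain ⟨δ, hδΓ, hδeq⟩ := Subgroup.mem_map.mp hmapped
  exact ⟨δ, hδΓ, hδeq⟩

/-- **Record levels are DISCRETE at `τ`** ([Deligne1979ShimuraVarieties] 2.1.2 pieces `Γ_g = gKg⁻¹ ∩ G(ℚ)` + discreteness of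
the ball-quotient groups at their distinguished place, ★ `UnitaryBallUniformisationDatum.finite_setOf_norm_τ₁_apply_le`):
for a rank-2 unitary Shimura-curve record `S` and ANY small level `Kc`, only finitely many `γ ∈ Γ_{J⋆}(Kc) = U(J⋆)(L⁺) ∩ Kc`
have all `τ`-entries of norm `≤ R`.
[cite: Deligne1979ShimuraVarieties, 2.1.2] [cite: Borel1969, §1 and Prop. 7.13] [cite: Milne2005ShimuraVarieties, Lemma 5.13 p. 57; Prop. 3.2 p. 32] -/
theorem RecordSystemGS.finite_setOf_mem_arithmeticLevel_norm_le (S : RecordSystemGS L Jstar τ K₀) (Kc : C5.SmallLevel K₀)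
    (R : ℝ) :
    {γ : GL (Fin 2) L | γ ∈ arithmeticLevel ↥(maximalRealSubfield L) L (IsCMField.complexConj L) 2 Jstar Kc.1.1 ∧
      ∀ i j, ‖τ ((γ : Matrix (Fin 2) (Fin 2) L) i j)‖ ≤ R}.Finite := by
  obtain ⟨X, D, γ', hH, hall⟩ := S.exists_piece_conj_forall Kc
  -- entry bounds for `τ(γ′)` and `τ(γ′⁻¹)`
  set C₁ : ℝ := ∑ i, ∑ j, ‖τ ((((γ' : ↥(rational ↥(maximalRealSubfield L) L (IsCMField.complexConj L) 2 Jstar)) :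
      GL (Fin 2) L) : Matrix (Fin 2) (Fin 2) L) i j)‖ with hC₁
  set C₂ : ℝ := ∑ i, ∑ j, ‖τ ((((γ'⁻¹ : ↥(rational ↥(maximalRealSubfield L) L (IsCMField.complexConj L) 2 Jstar)) :
      GL (Fin 2) L) : Matrix (Fin 2) (Fin 2) L) i j)‖ with hC₂
  have hle_sum : ∀ (M : Matrix (Fin 2) (Fin 2) L) (i j : Fin 2), ‖τ (M i j)‖ ≤ ∑ i', ∑ j', ‖τ (M i' j')‖ :=
    fun M i j =>
    calc ‖τ (M i j)‖ ≤ ∑ j', ‖τ (M i j')‖ :=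
          Finset.single_le_sum (f := fun j' ↦ ‖τ (M i j')‖) (fun _ _ ↦ norm_nonneg _) (Finset.mem_univ j)
      _ ≤ ∑ i', ∑ j', ‖τ (M i' j')‖ :=
          Finset.single_le_sum (f := fun i' ↦ ∑ j', ‖τ (M i' j')‖) (fun _ _ ↦ Finset.sum_nonneg fun _ _ ↦ norm_nonneg _)
            (Finset.mem_univ i)
  -- the finite target: ball-group elements with `τ₁`-entries bounded by `R' := 2 · (2 · C₁ · R) · C₂`
  set R' : ℝ := Fintype.card (Fin (1 + 1)) * ((Fintype.card (Fin (1 + 1)) * (C₁ * R)) * C₂) with hR'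
  have hfin := D.finite_setOf_norm_τ₁_apply_le R'
  -- the comparison map `γ ↦ (γ′ γ γ′⁻¹)^τ`, injective on `GL₂(L)`
  let Φ : GL (Fin 2) L → GL (Fin (1 + 1)) ℂ := fun γ =>
    Matrix.GeneralLinearGroup.map τ
      ((((γ' : ↥(rational ↥(maximalRealSubfield L) L (IsCMField.complexConj L) 2 Jstar)) : GL (Fin 2) L)) * γ *
        (((γ'⁻¹ : ↥(rational ↥(maximalRealSubfield L) L (IsCMField.complexConj L) 2 Jstar)) : GL (Fin 2) L)))
  have hΦinj : Injective Φ := by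
    intro x y hxy
    have h1 := glMap_injective' (m := Fin 2) τ.injective hxy
    simpa [mul_left_cancel_iff, mul_right_cancel_iff] using h1
  -- the finite set of `τ₁`-images of bounded ball-group elements
  let T : Set (GL (Fin (1 + 1)) ℂ) :=
    (fun δ : ↥D.Γ => Matrix.GeneralLinearGroup.map (D.τ₁ : ↥D.E →+* ℂ) (δ : GL (Fin (1 + 1)) ↥D.E)) ''
      {δ : ↥D.Γ | ∀ i j, ‖D.τ₁ ((((δ : ↥D.Γ) : GL (Fin (1 + 1)) ↥D.E) : Matrix (Fin (1 + 1)) (Fin (1 + 1)) ↥D.E) i j)‖ ≤ R'}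
  have hTfin : T.Finite := hfin.image _
  refine (hTfin.preimage hΦinj.injOn).subset fun γ hγ => ?_
  obtain ⟨hγmem, hγR⟩ := hγ
  obtain ⟨hγrat, hγK⟩ := mem_arithmeticLevel_iff.mp hγmem
  obtain ⟨δ, hδΓ, hδeq⟩ := hall ⟨γ, hγrat⟩ hγK
  -- `Φ γ = δ^{τ₁}`
  have hΦγ : Φ γ = Matrix.GeneralLinearGroup.map (D.τ₁ : ↥D.E →+* ℂ) δ := by
    rw [hδeq]
    simp only [Φ, MulAut.conj_apply, Subgroup.coe_mul, InvMemClass.coe_inv]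
  refine ⟨⟨δ, hδΓ⟩, ?_, hΦγ.symm⟩
  -- the `τ₁`-entries of `δ` are the `τ`-entries of `γ′ γ γ′⁻¹`, bounded by `R'`
  intro i j
  set P : Matrix (Fin 2) (Fin 2) ℂ :=
    (((γ' : ↥(rational ↥(maximalRealSubfield L) L (IsCMField.complexConj L) 2 Jstar)) : GL (Fin 2) L) :
      Matrix (Fin 2) (Fin 2) L).map τ with hP
  set Q : Matrix (Fin 2) (Fin 2) ℂ :=
    (((γ'⁻¹ : ↥(rational ↥(maximalRealSubfield L) L (IsCMField.complexConj L) 2 Jstar)) : GL (Fin 2) L) :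
      Matrix (Fin 2) (Fin 2) L).map τ with hQ
  set G : Matrix (Fin 2) (Fin 2) ℂ := (γ : Matrix (Fin 2) (Fin 2) L).map τ with hG
  have hPb : ∀ i j, ‖P i j‖ ≤ C₁ := fun i j => by
    rw [hP, Matrix.map_apply]
    exact hle_sum _ i j
  have hQb : ∀ i j, ‖Q i j‖ ≤ C₂ := fun i j => by
    rw [hQ, Matrix.map_apply]
    exact hle_sum _ i j
  have hGb : ∀ i j, ‖G i j‖ ≤ R := fun i j => by
    rw [hG, Matrix.map_apply]
    exact hγR i j
  have h12 : ∀ i j, ‖(P * G) i j‖ ≤ Fintype.card (Fin (1 + 1)) * (C₁ * R) := fun i j =>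
    norm_mul_apply_le_card'' (m := Fin 2) hPb hGb i j
  have h123 : ‖(P * G * Q) i j‖ ≤ R' := norm_mul_apply_le_card'' (m := Fin 2) h12 hQb i j
  have hentry : (((δ : GL (Fin (1 + 1)) ↥D.E) : Matrix (Fin (1 + 1)) (Fin (1 + 1)) ↥D.E).map (D.τ₁ : ↥D.E →+* ℂ)) =
      P * G * Q := by
    have h := congrArg (fun u : GL (Fin (1 + 1)) ℂ => (u : Matrix (Fin (1 + 1)) (Fin (1 + 1)) ℂ)) hΦγ
    simp only [Φ, coe_glMap', Units.val_mul, Matrix.map_mul] at h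
    rw [hP, hG, hQ]
    exact h.symm
  have := congrFun (congrFun hentry i) j
  rw [Matrix.map_apply] at this
  change ‖D.τ₁ ((((δ : GL (Fin (1 + 1)) ↥D.E) : Matrix (Fin (1 + 1)) (Fin (1 + 1)) ↥D.E)) i j)‖ ≤ R'
  rw [this]
  exact h123

/-- **The same finiteness for every subgroup of a record level** (e.g. a principal congruence subgroup
`Γ_{J⋆}(n) ≤ Γ_{J⋆}(Kc)`, ★ `isCongruenceSubgroup_arithmeticLevel_of_isOpen`): only finitely many of its elements have all
`τ`-entries of norm `≤ R`. [cite: Deligne1979ShimuraVarieties, 2.1.2] [cite: Borel1969, §1 and Prop. 7.13] -/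
theorem RecordSystemGS.finite_setOf_mem_norm_le_of_le_arithmeticLevel (S : RecordSystemGS L Jstar τ K₀)
    (Kc : C5.SmallLevel K₀) {Γ : Subgroup (GL (Fin 2) L)}
    (hΓ : Γ ≤ arithmeticLevel ↥(maximalRealSubfield L) L (IsCMField.complexConj L) 2 Jstar Kc.1.1) (R : ℝ) :
    {γ : GL (Fin 2) L | γ ∈ Γ ∧ ∀ i j, ‖τ ((γ : Matrix (Fin 2) (Fin 2) L) i j)‖ ≤ R}.Finite :=
  (S.finite_setOf_mem_arithmeticLevel_norm_le Kc R).subset fun _ hγ => ⟨hΓ hγ.1, hγ.2⟩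

end UnitaryCanonicalModel

end Literature.AlgebraicGeometry.ShimuraVarieties

end
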